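import Literature.AlgebraicGeometry.Resolution.LogRegularResolutionGeneralHolds
import HarnessLib

/-!
# Crux `Picover` (stmt-ResolutionOfSingularities-0554), line `giraud-separated-base`: the literature stub
# `stub_logResolution` — Kato 1994 (10.4), atlas form — CLOSED BY NAME

The registered skeleton of crux `PAlteration.Picover` (stmt-0554, line `giraud-separated-base`, lead a3)
carries the literature stub `stub_logResolution : Kato1994_logRegular_hasResolution_general.{0}` (a scheme
with a log regular Zariski fs atlas has a resolution of singularities; Kato 1994 (10.4) / Nizioł 2006
Thm. 5.8). That named fact is now a THEOREM of the tree —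
`Literature.AlgebraicGeometry.Resolution.Kato1994_logRegular_hasResolution_general_holds`
(`LogRegularResolutionGeneralHolds.lean`, 2026-08-27: linked KKMS regular refinement of the face fans +
the scheme-side assembly; seat res-L0-w81-pv-2 g2 with res-lit-3 / res-type-037 / res-type-043). This file
lands the stub BY NAME AND SIGNATURE for the 0554 register; after it the line's only open stub is
`stub_giraudNormalFormSep` (= item stmt-ResolutionOfSingularities-18001). No new mathematics.
-/

set_option linter.dupNamespace false -- mandated namespace of this single-conjunct summit

open Literature.AlgebraicGeometry.Resolution

namespace Summit.ResolutionOfSingularities.ResolutionOfSingularities.Theorems.Picover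

/-- **Registered stub `stub_logResolution` of crux `Picover` (stmt-0554), BY NAME AND SIGNATURE**:
Kato 1994 (10.4), atlas form — every scheme carrying a log regular Zariski fs atlas (`LogRegularAtlas`)
has a resolution of singularities. Discharged by `Kato1994_logRegular_hasResolution_general_holds`.
[cite: Kato1994, (10.4)] -/
theorem stub_logResolution : Kato1994_logRegular_hasResolution_general.{0} :=
  Kato1994_logRegular_hasResolution_general_holds.{0}

end Summit.ResolutionOfSingularities.ResolutionOfSingularities.Theorems.Picover
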